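import Summits.Ventures.HodgeRepro2.T5SU11LegendreBound
import Summits.Ventures.HodgeRepro2.T5SU11JacobiLegendreLeading
import Mathlib.Analysis.SpecialFunctions.Integrals.Basic

/-!
# The Legendre functions of the second kind `Q_n` (Neumann's integral): `Q_0 = ½ log((x+1)/(x−1))`,
Bonnet's recursion, `Q_n = P_n Q_0 − W_{n−1}` with `W_{n−1}` a polynomial of degree `n − 1`

For `x > 1` NEUMANN'S INTEGRAL

  `Q_n(x) := ½ ∫_{−1}^{1} P_n(t)/(x − t) dt`   (`legQ2 n x`)

defines the Legendre function of the second kind (the integrand is continuous on `[−1, 1]` since `x − t ≥ x − 1 > 0`).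
Its first values are **`Q_0(x) = ½ log((x + 1)/(x − 1))`** (`legQ2_zero`) and **`Q_1(x) = x Q_0(x) − 1`**
(`legQ2_one`); Bonnet's recursion for `P_n` and `∫_{−1}^{1} P_{n+1} = 0` (row 378) give the same recursion

  **`(n + 2) Q_{n+2} = (2n + 3) x Q_{n+1} − (n + 1) Q_n`**   (`legQ2_succ_succ`),

and the two-step induction with `W_0 = 0`, `W_1 = 1`, `(n + 2) W_{n+2} = (2n + 3) X W_{n+1} − (n + 1) W_n` (`legW`, a
polynomial of degree `≤ n − 1`, `natDegree_legW_le`) yields CHRISTOFFEL'S FORM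

  **`Q_n(x) = P_n(x) Q_0(x) − W_n(x)`**   (`legQ2_eq`),

so every `Q_n` is a polynomial multiple of `log((x + 1)/(x − 1))` plus a polynomial. Also **`|Q_n(x)| ≤ 1/(x − 1)`**
(`abs_legQ2_le`, from `|P_n| ≤ 1`) and `Q_n(x) → 0` as `x → ∞` (`tendsto_legQ2_atTop`). Nothing is claimed
about (N).

Blind lane: Mathlib + the HodgeRepro2 prefix only; no sorry; axioms ⊆ {propext, Classical.choice,
Quot.sound}.
-/

namespace Summit.Ventures.HodgeRepro2.T5SU11LegendreSecondKind

open Polynomial intervalIntegral Finset Filter Topology MeasureTheory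
open Set (Icc Ioi Ioo uIcc uIoc)
open T5SU11SphericalLegendreAll T5SU11JacobiPhaseLawEven T5SU11JacobiLegendreLeading T5SU11LegendreIdentities
  T5SU11LegendreBound

/-! ### Neumann's integral -/

/-- **The Legendre function of the second kind** `Q_n(x) = ½ ∫_{−1}^{1} P_n(t)/(x − t) dt` (meaningful for `x > 1`). -/
noncomputable def legQ2 (n : ℕ) (x : ℝ) : ℝ := (1 / 2) * ∫ t in (-1 : ℝ)..1, legP n t / (x - t)

/-- For `x > 1` the integrand `t ↦ g(t)/(x − t)` is continuous on `[−1, 1]` for every continuous `g`. -/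
theorem continuousOn_div_sub {g : ℝ → ℝ} (hg : Continuous g) {x : ℝ} (hx : 1 < x) :
    ContinuousOn (fun t => g t / (x - t)) (Icc (-1 : ℝ) 1) := by
  refine hg.continuousOn.div (continuous_const.sub continuous_id).continuousOn fun t ht => ?_
  have : t < x := lt_of_le_of_lt ht.2 hx
  linarith

/-- Interval integrability of `g(t)/(x − t)` on `[−1, 1]` for `x > 1`. -/
theorem intervalIntegrable_div_sub {g : ℝ → ℝ} (hg : Continuous g) {x : ℝ} (hx : 1 < x) :
    IntervalIntegrable (fun t => g t / (x - t)) volume (-1 : ℝ) 1 :=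
  (continuousOn_div_sub hg hx).intervalIntegrable_of_Icc (by norm_num)

/-- **`Q_0(x) = ½ log((x + 1)/(x − 1))`** for `x > 1`. -/
theorem legQ2_zero {x : ℝ} (hx : 1 < x) : legQ2 0 x = (1 / 2) * Real.log ((x + 1) / (x - 1)) := by
  unfold legQ2
  congr 1
  have e : ∀ t, legP 0 t / (x - t) = (fun u => 1 / u) (x - t) := fun t => by simp [legP_zero]
  simp_rw [e]
  rw [integral_comp_sub_left (fun u : ℝ => 1 / u) x, integral_one_div_of_pos (by linarith) (by linarith)]
  congr 1
  ring

/-- **`|Q_n(x)| ≤ 1/(x − 1)`** for `x > 1` (`|P_n| ≤ 1` and `x − t ≥ x − 1`). -/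
theorem abs_legQ2_le (n : ℕ) {x : ℝ} (hx : 1 < x) : |legQ2 n x| ≤ 1 / (x - 1) := by
  have hpos : 0 < x - 1 := by linarith
  have hb : ∀ t ∈ uIoc (-1 : ℝ) 1, ‖legP n t / (x - t)‖ ≤ 1 / (x - 1) := by
    intro t ht
    have ht' : t ∈ Icc (-1 : ℝ) 1 := by
      rw [Set.uIoc_of_le (by norm_num)] at ht
      exact Set.Ioc_subset_Icc_self ht
    have hxt : x - 1 ≤ x - t := by linarith [ht'.2]
    rw [Real.norm_eq_abs, abs_div, abs_of_pos (lt_of_lt_of_le hpos hxt)]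
    exact div_le_div₀ (by norm_num) (abs_legP_le_one n ht') hpos hxt
  have hI := intervalIntegral.norm_integral_le_of_norm_le_const hb
  rw [Real.norm_eq_abs] at hI
  unfold legQ2
  rw [abs_mul, abs_of_pos (by norm_num : (0 : ℝ) < 1 / 2)]
  calc (1 / 2) * |∫ t in (-1 : ℝ)..1, legP n t / (x - t)| ≤ (1 / 2) * (1 / (x - 1) * |(1 : ℝ) - (-1)|) :=
        mul_le_mul_of_nonneg_left hI (by norm_num)
    _ = 1 / (x - 1) := by norm_num; ring

/-- **`Q_n(x) → 0` as `x → ∞`.** -/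
theorem tendsto_legQ2_atTop (n : ℕ) : Tendsto (legQ2 n) atTop (𝓝 0) := by
  rw [Metric.tendsto_atTop]
  intro ε hε
  refine ⟨1 + 1 / ε + 1, fun x hx => ?_⟩
  have hx1 : 1 < x := by
    have : 0 < 1 / ε := by positivity
    linarith
  rw [Real.dist_eq, sub_zero]
  refine lt_of_le_of_lt (abs_legQ2_le n hx1) ?_
  have hpos : 0 < x - 1 := by linarith
  rw [div_lt_iff₀ hpos]
  have h1 : 1 / ε + 1 ≤ x - 1 := by linarith
  calc (1 : ℝ) < ε * (1 / ε + 1) := by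
        rw [mul_add, mul_one_div_cancel hε.ne', mul_one]
        linarith
    _ ≤ ε * (x - 1) := mul_le_mul_of_nonneg_left h1 hε.le

/-! ### Bonnet's recursion for `Q_n` -/

/-- `∫ t g(t)/(x − t) = x ∫ g(t)/(x − t) − ∫ g` for continuous `g` and `x > 1` (`t/(x − t) = x/(x − t) − 1`). -/
theorem integral_mul_div_sub {g : ℝ → ℝ} (hg : Continuous g) {x : ℝ} (hx : 1 < x) :
    ∫ t in (-1 : ℝ)..1, t * g t / (x - t)
      = x * (∫ t in (-1 : ℝ)..1, g t / (x - t)) - ∫ t in (-1 : ℝ)..1, g t := by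
  have e : ∀ t ∈ Icc (-1 : ℝ) 1, t * g t / (x - t) = x * (g t / (x - t)) - g t := fun t ht => by
    have : x - t ≠ 0 := by
      have : t < x := lt_of_le_of_lt ht.2 hx
      linarith
    field_simp
    ring
  rw [← intervalIntegral.integral_const_mul,
    ← integral_sub ((intervalIntegrable_div_sub hg hx).const_mul x) (hg.intervalIntegrable _ _)]
  refine integral_congr fun t ht => ?_
  rw [Set.uIcc_of_le (by norm_num)] at ht
  exact e t ht

/-- **Bonnet's recursion for `Q_n`**: `(n + 2) Q_{n+2}(x) = (2n + 3) x Q_{n+1}(x) − (n + 1) Q_n(x)` for `x > 1`. -/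
theorem legQ2_succ_succ (n : ℕ) {x : ℝ} (hx : 1 < x) :
    ((n : ℝ) + 2) * legQ2 (n + 2) x = (2 * (n : ℝ) + 3) * x * legQ2 (n + 1) x - ((n : ℝ) + 1) * legQ2 n x := by
  unfold legQ2
  have e : ∀ t ∈ Icc (-1 : ℝ) 1, ((n : ℝ) + 2) * (legP (n + 2) t / (x - t))
      = (2 * (n : ℝ) + 3) * (t * legP (n + 1) t / (x - t)) - ((n : ℝ) + 1) * (legP n t / (x - t)) := by
    intro t ht
    have hxt : x - t ≠ 0 := by
      have : t < x := lt_of_le_of_lt ht.2 hx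
      linarith
    rw [legP_succ_succ]
    field_simp
  have i1 := intervalIntegrable_div_sub (continuous_legP (n + 2)) hx
  have i2 : IntervalIntegrable (fun t => t * legP (n + 1) t / (x - t)) volume (-1 : ℝ) 1 :=
    intervalIntegrable_div_sub (continuous_id.mul (continuous_legP (n + 1))) hx
  have i3 := intervalIntegrable_div_sub (continuous_legP n) hx
  have h : ((n : ℝ) + 2) * ∫ t in (-1 : ℝ)..1, legP (n + 2) t / (x - t)
      = (2 * (n : ℝ) + 3) * (∫ t in (-1 : ℝ)..1, t * legP (n + 1) t / (x - t))
        - ((n : ℝ) + 1) * ∫ t in (-1 : ℝ)..1, legP n t / (x - t) := by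
    rw [← intervalIntegral.integral_const_mul, ← intervalIntegral.integral_const_mul,
      ← intervalIntegral.integral_const_mul, ← integral_sub (i2.const_mul _) (i3.const_mul _)]
    refine integral_congr fun t ht => ?_
    rw [Set.uIcc_of_le (by norm_num)] at ht
    exact e t ht
  rw [integral_mul_div_sub (continuous_legP (n + 1)) hx, integral_legP_succ_neg_one_one, sub_zero] at h
  linear_combination (1 / 2 : ℝ) * h

/-- **`Q_1(x) = x Q_0(x) − 1`** for `x > 1`. -/
theorem legQ2_one {x : ℝ} (hx : 1 < x) : legQ2 1 x = x * legQ2 0 x - 1 := by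
  unfold legQ2
  have e : ∀ t, legP 1 t / (x - t) = t * legP 0 t / (x - t) := fun t => by simp [legP_zero]
  simp_rw [e]
  rw [integral_mul_div_sub (continuous_legP 0) hx]
  have : ∫ t in (-1 : ℝ)..1, legP 0 t = 2 := by
    simp only [legP_zero, intervalIntegral.integral_const, smul_eq_mul, mul_one]
    norm_num
  rw [this]
  ring

/-! ### Christoffel's form `Q_n = P_n Q_0 − W_n` -/

/-- **The Christoffel polynomials** `W_0 = 0`, `W_1 = 1`, `(n + 2) W_{n+2} = (2n + 3) X W_{n+1} − (n + 1) W_n`. -/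
noncomputable def legW : ℕ → ℝ[X]
  | 0 => 0
  | 1 => 1
  | (n + 2) => C ((2 * (n : ℝ) + 3) / ((n : ℝ) + 2)) * X * legW (n + 1) - C (((n : ℝ) + 1) / ((n : ℝ) + 2)) * legW n

/-- The recursion of `legW`, unfolded. -/
theorem legW_succ_succ (n : ℕ) :
    legW (n + 2) = C ((2 * (n : ℝ) + 3) / ((n : ℝ) + 2)) * X * legW (n + 1)
      - C (((n : ℝ) + 1) / ((n : ℝ) + 2)) * legW n := rfl

/-- `natDegree W_{n+1} ≤ n` (and `W_0 = 0`). -/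
theorem natDegree_legW_le_pair (n : ℕ) : (legW (n + 1)).natDegree ≤ n ∧ (legW (n + 2)).natDegree ≤ n + 1 := by
  induction n with
  | zero =>
    refine ⟨by simp [legW], ?_⟩
    rw [legW_succ_succ]
    simp only [zero_add, legW, mul_one, mul_zero, sub_zero]
    exact (natDegree_C_mul_le _ _).trans natDegree_X_le
  | succ n ih =>
    refine ⟨ih.2, ?_⟩
    rw [legW_succ_succ]
    refine (natDegree_sub_le _ _).trans (max_le ?_ ?_)
    · calc (C ((2 * ((n + 1 : ℕ) : ℝ) + 3) / (((n + 1 : ℕ) : ℝ) + 2)) * X * legW (n + 1 + 1)).natDegree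
          ≤ (C ((2 * ((n + 1 : ℕ) : ℝ) + 3) / (((n + 1 : ℕ) : ℝ) + 2)) * X).natDegree
            + (legW (n + 1 + 1)).natDegree := natDegree_mul_le
        _ ≤ 1 + (n + 1) := add_le_add ((natDegree_C_mul_le _ _).trans natDegree_X_le) ih.2
        _ = n + 1 + 1 := by ring
    · exact (natDegree_C_mul_le _ _).trans (ih.1.trans (by omega))

/-- **`natDegree W_{n+1} ≤ n`**: `W_n` is a polynomial of degree `≤ n − 1`. -/
theorem natDegree_legW_le (n : ℕ) : (legW (n + 1)).natDegree ≤ n := (natDegree_legW_le_pair n).1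

/-- **CHRISTOFFEL'S FORM**: `Q_n(x) = P_n(x) Q_0(x) − W_n(x)` for `x > 1` (two-step induction on Bonnet's recursion). -/
theorem legQ2_eq_pair (n : ℕ) {x : ℝ} (hx : 1 < x) :
    legQ2 n x = legP n x * legQ2 0 x - (legW n).eval x
      ∧ legQ2 (n + 1) x = legP (n + 1) x * legQ2 0 x - (legW (n + 1)).eval x := by
  induction n with
  | zero => exact ⟨by simp [legW], by rw [legQ2_one hx]; simp [legW]⟩
  | succ n ih =>
    refine ⟨ih.2, ?_⟩
    have hQ := legQ2_succ_succ n hx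
    have hP := legP_succ_succ n x
    rw [ih.1, ih.2] at hQ
    have hn : ((n : ℝ) + 2) ≠ 0 := by positivity
    rw [legW_succ_succ, eval_sub, eval_mul, eval_mul, eval_C, eval_X, eval_mul, eval_C, hP]
    field_simp
    linear_combination hQ

/-- **`Q_n = P_n Q_0 − W_n`** for `x > 1`. -/
theorem legQ2_eq (n : ℕ) {x : ℝ} (hx : 1 < x) : legQ2 n x = legP n x * legQ2 0 x - (legW n).eval x :=
  (legQ2_eq_pair n hx).1

/-- `Q_n(x) = ½ P_n(x) log((x + 1)/(x − 1)) − W_n(x)` for `x > 1`. -/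
theorem legQ2_eq_log (n : ℕ) {x : ℝ} (hx : 1 < x) :
    legQ2 n x = (1 / 2) * legP n x * Real.log ((x + 1) / (x - 1)) - (legW n).eval x := by
  rw [legQ2_eq n hx, legQ2_zero hx]
  ring

end Summit.Ventures.HodgeRepro2.T5SU11LegendreSecondKind
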